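import Summits.SmoothPoincare4.SmoothPoincare4.Theorems.SymplecticOrigamiGromovRecognitionRelEndStubCapModelGlueACS

/-!
# Wedge cap for `GromovRecognitionRelEnd` — gluing almost complex structures along a pushout, II
(stub `stub_capModel` of line `cross-cap-laurent`, crux `SymplecticOrigami.GromovRecognitionRelEnd`,
item stmt-SmoothPoincare4-11009; generic auxiliary file)

For a gluing datum `d : SmoothGlueData 𝓘(ℝ, E) 𝓘(ℝ, E) A B E` (two manifolds modelled on the same
vector space `E`, glued along the partial diffeomorphism `d.glue`) and almost complex structures
`J_A`, `J_B` on the pieces such that `d.glue` is `(J_A, J_B)`-holomorphic on its source, the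
push-forwards `inl_* J_A`, `inr_* J_B` agree on the overlap (`pushEnd_inl_eq_pushEnd_inr`) and glue
to an almost complex structure `d.glueACS` on `d.Glued` for which `inl` and `inr` are holomorphic
(`glueACS_inl`, `glueACS_inr`). McDuff–Salamon 2017, §4.1 (almost complex structures are sections
of `End(TM)`, i.e. local data); Kosinski VI.1 (the pushout).
-/

noncomputable section

-- the registered namespace `Summit.SmoothPoincare4.SmoothPoincare4.Theorems…` repeats a component
set_option linter.dupNamespace false

open scoped Manifold ContDiff Topology
open Bundle Set Function Filter Literature.Geometry.Symplectic Literature.Topology.FourManifolds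

namespace Summit.SmoothPoincare4.SmoothPoincare4.Theorems.GromovRecognitionRelEnd.CrossCapLaurent

namespace CapModel

universe uA uB

variable {E : Type*} [NormedAddCommGroup E] [NormedSpace ℝ E]
  {A : Type uA} [TopologicalSpace A] [ChartedSpace E A] [IsManifold 𝓘(ℝ, E) ∞ A]
  {B : Type uB} [TopologicalSpace B] [ChartedSpace E B] [IsManifold 𝓘(ℝ, E) ∞ B]
  (d : SmoothGlueData 𝓘(ℝ, E) 𝓘(ℝ, E) A B E)

namespace GlueJ

/-! ## The gluing map and its differential -/

omit [IsManifold 𝓘(ℝ, E) ∞ A] [IsManifold 𝓘(ℝ, E) ∞ B] in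
/-- The gluing map is `C^∞` at the points of its source. [folklore] -/
theorem contMDiffAt_glue {a : A} (ha : a ∈ d.glue.source) : ContMDiffAt 𝓘(ℝ, E) 𝓘(ℝ, E) ∞ d.glue a :=
  (d.contMDiffOn_glue a ha).contMDiffAt (d.glue.open_source.mem_nhds ha)

omit [IsManifold 𝓘(ℝ, E) ∞ A] [IsManifold 𝓘(ℝ, E) ∞ B] in
/-- The inverse gluing map is `C^∞` at the points of its source. [folklore] -/
theorem contMDiffAt_glue_symm {b : B} (hb : b ∈ d.glue.target) :
    ContMDiffAt 𝓘(ℝ, E) 𝓘(ℝ, E) ∞ d.glue.symm b :=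
  (d.contMDiffOn_glue_symm b hb).contMDiffAt (d.glue.open_target.mem_nhds hb)

omit [IsManifold 𝓘(ℝ, E) ∞ A] [IsManifold 𝓘(ℝ, E) ∞ B] in
/-- `d(glue) ∘ d(glue⁻¹) = id` at a point of the target. [folklore] -/
theorem mfderiv_glue_apply_mfderiv_glue_symm {b : B} (hb : b ∈ d.glue.target) (u : E) :
    mfderiv 𝓘(ℝ, E) 𝓘(ℝ, E) d.glue (d.glue.symm b) (mfderiv 𝓘(ℝ, E) 𝓘(ℝ, E) d.glue.symm b u) = u := by
  have h1 : MDifferentiableAt 𝓘(ℝ, E) 𝓘(ℝ, E) d.glue (d.glue.symm b) :=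
    (contMDiffAt_glue d (d.glue.map_target hb)).mdifferentiableAt (by simp)
  have h2 : MDifferentiableAt 𝓘(ℝ, E) 𝓘(ℝ, E) d.glue.symm b :=
    (contMDiffAt_glue_symm d hb).mdifferentiableAt (by simp)
  have hev : (d.glue ∘ d.glue.symm) =ᶠ[𝓝 b] id := by
    filter_upwards [d.glue.open_target.mem_nhds hb] with b' hb'
    exact d.glue.right_inv hb'
  have h := mfderiv_comp b h1 h2
  rw [hev.mfderiv_eq, mfderiv_id] at h
  exact (congrArg (fun L : E →L[ℝ] E => L u) h).symm

/-- **`d(inl)_a = d(inr)_{glue a} ∘ d(glue)_a`** on the source (`inl = inr ∘ glue` there). [folklore] -/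
theorem mfderiv_inl_eq {a : A} (ha : a ∈ d.glue.source) (v : E) :
    mfderiv 𝓘(ℝ, E) 𝓘(ℝ, E) d.inl a v =
      mfderiv 𝓘(ℝ, E) 𝓘(ℝ, E) d.inr (d.glue a) (mfderiv 𝓘(ℝ, E) 𝓘(ℝ, E) d.glue a v) := by
  have hev : d.inl =ᶠ[𝓝 a] (d.inr ∘ d.glue) := by
    filter_upwards [d.glue.open_source.mem_nhds ha] with a' ha'
    exact (d.inr_glue ha').symm
  have h1 : MDifferentiableAt 𝓘(ℝ, E) 𝓘(ℝ, E) d.inr (d.glue a) :=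
    (d.contMDiff_inr _).mdifferentiableAt (by simp)
  have h2 : MDifferentiableAt 𝓘(ℝ, E) 𝓘(ℝ, E) d.glue a :=
    (contMDiffAt_glue d ha).mdifferentiableAt (by simp)
  rw [hev.mfderiv_eq, mfderiv_comp a h1 h2]
  rfl

variable [Nonempty A] [Nonempty B]

omit [IsManifold 𝓘(ℝ, E) ∞ A] [IsManifold 𝓘(ℝ, E) ∞ B] [Nonempty B] in
/-- On the target, `inl⁻¹ ∘ inr = glue⁻¹`. [folklore] -/
theorem invFun_inl_inr {b : B} (hb : b ∈ d.glue.target) : invFun d.inl (d.inr b) = d.glue.symm b := by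
  rw [← d.inl_glue_symm hb, invFun_apply d.inl_injective]

omit [Nonempty B] in
/-- **`d(inl⁻¹)_{inr b} ∘ d(inr)_b = d(glue⁻¹)_b`** on the target. [folklore] -/
theorem mfderiv_invFun_inl_inr {b : B} (hb : b ∈ d.glue.target) (u : E) :
    mfderiv 𝓘(ℝ, E) 𝓘(ℝ, E) (invFun d.inl) (d.inr b) (mfderiv 𝓘(ℝ, E) 𝓘(ℝ, E) d.inr b u) =
      mfderiv 𝓘(ℝ, E) 𝓘(ℝ, E) d.glue.symm b u := by
  have hev : (invFun d.inl ∘ d.inr) =ᶠ[𝓝 b] d.glue.symm := by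
    filter_upwards [d.glue.open_target.mem_nhds hb] with b' hb'
    exact invFun_inl_inr d hb'
  have h1 : MDifferentiableAt 𝓘(ℝ, E) 𝓘(ℝ, E) (invFun d.inl) (d.inr b) := by
    have hmem : d.inr b ∈ range d.inl := d.inr_mem_range_inl_iff.2 hb
    exact (contMDiffAt_invFun d.isSmoothEmbedding_inl d.isOpen_range_inl hmem).mdifferentiableAt
      (by simp)
  have h2 : MDifferentiableAt 𝓘(ℝ, E) 𝓘(ℝ, E) d.inr b :=
    (d.contMDiff_inr _).mdifferentiableAt (by simp)
  have h := mfderiv_comp b h1 h2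
  rw [hev.mfderiv_eq] at h
  exact (congrArg (fun L : E →L[ℝ] E => L u) h).symm

/-! ## The two push-forwards agree on the overlap -/

variable {d} in
/-- **Compatibility on the overlap.** If `glue` is `(J_A, J_B)`-holomorphic, then at a point of
`range inl ∩ range inr` the push-forwards `inl_* J_A` and `inr_* J_B` coincide. [cite: McDuffSalamon2017, §4.1] -/
theorem pushEnd_inl_eq_pushEnd_inr (JA : AlmostComplexStructure 𝓘(ℝ, E) ∞ A)
    (JB : AlmostComplexStructure 𝓘(ℝ, E) ∞ B)
    (hol : ∀ a ∈ d.glue.source, ∀ v : E, mfderiv 𝓘(ℝ, E) 𝓘(ℝ, E) d.glue a (JA a v) =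
      JB (d.glue a) (mfderiv 𝓘(ℝ, E) 𝓘(ℝ, E) d.glue a v))
    {y : d.Glued} (hyl : y ∈ range d.inl) (hyr : y ∈ range d.inr) :
    pushEnd 𝓘(ℝ, E) 𝓘(ℝ, E) d.inl JA y = pushEnd 𝓘(ℝ, E) 𝓘(ℝ, E) d.inr JB y := by
  obtain ⟨b, rfl⟩ := hyr
  have hb : b ∈ d.glue.target := d.inr_mem_range_inl_iff.1 hyl
  have ha : d.glue.symm b ∈ d.glue.source := d.glue.map_target hb
  have hab : d.glue (d.glue.symm b) = b := d.glue.right_inv hb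
  ext w
  obtain ⟨u, rfl⟩ := mfderiv_surjective d.isSmoothEmbedding_inr d.isOpen_range_inr b w
  rw [pushEnd_mfderiv d.isSmoothEmbedding_inr d.isOpen_range_inr]
  -- the left-hand side, step by step (all vectors live in `E`)
  change mfderiv 𝓘(ℝ, E) 𝓘(ℝ, E) d.inl (invFun d.inl (d.inr b)) (JA (invFun d.inl (d.inr b))
    (mfderiv 𝓘(ℝ, E) 𝓘(ℝ, E) (invFun d.inl) (d.inr b) (mfderiv 𝓘(ℝ, E) 𝓘(ℝ, E) d.inr b u))) = _
  rw [mfderiv_invFun_inl_inr d hb, invFun_inl_inr d hb, mfderiv_inl_eq d ha, hol _ ha,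
    mfderiv_glue_apply_mfderiv_glue_symm d hb, hab]

/-! ## The glued structure -/

/-- The glued endomorphism field: `inl_* J_A` on `range inl`, `inr_* J_B` elsewhere. [folklore] -/
def glueEnd (JA : AlmostComplexStructure 𝓘(ℝ, E) ∞ A) (JB : AlmostComplexStructure 𝓘(ℝ, E) ∞ B)
    (y : d.Glued) : TangentSpace 𝓘(ℝ, E) y →L[ℝ] TangentSpace 𝓘(ℝ, E) y :=
  open scoped Classical in
  if y ∈ range d.inl then pushEnd 𝓘(ℝ, E) 𝓘(ℝ, E) d.inl JA y
  else pushEnd 𝓘(ℝ, E) 𝓘(ℝ, E) d.inr JB y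

variable {d} in
/-- On `range inl` the glued field is `inl_* J_A`. [folklore] -/
theorem glueEnd_of_mem_inl (JA : AlmostComplexStructure 𝓘(ℝ, E) ∞ A)
    (JB : AlmostComplexStructure 𝓘(ℝ, E) ∞ B) {y : d.Glued} (hy : y ∈ range d.inl) :
    glueEnd d JA JB y = pushEnd 𝓘(ℝ, E) 𝓘(ℝ, E) d.inl JA y := by
  simp only [glueEnd, hy, if_true]

variable {d} in
/-- On `range inr` the glued field is `inr_* J_B` (by compatibility on the overlap). [folklore] -/
theorem glueEnd_of_mem_inr (JA : AlmostComplexStructure 𝓘(ℝ, E) ∞ A)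
    (JB : AlmostComplexStructure 𝓘(ℝ, E) ∞ B)
    (hol : ∀ a ∈ d.glue.source, ∀ v : E, mfderiv 𝓘(ℝ, E) 𝓘(ℝ, E) d.glue a (JA a v) =
      JB (d.glue a) (mfderiv 𝓘(ℝ, E) 𝓘(ℝ, E) d.glue a v))
    {y : d.Glued} (hy : y ∈ range d.inr) :
    glueEnd d JA JB y = pushEnd 𝓘(ℝ, E) 𝓘(ℝ, E) d.inr JB y := by
  by_cases hyl : y ∈ range d.inl
  · rw [glueEnd_of_mem_inl JA JB hyl, pushEnd_inl_eq_pushEnd_inr JA JB hol hyl hy]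
  · simp only [glueEnd, hyl, if_false]

/-- **Gluing almost complex structures along a pushout.** [cite: McDuffSalamon2017, §4.1] -/
def glueACS (JA : AlmostComplexStructure 𝓘(ℝ, E) ∞ A) (JB : AlmostComplexStructure 𝓘(ℝ, E) ∞ B)
    (hol : ∀ a ∈ d.glue.source, ∀ v : E, mfderiv 𝓘(ℝ, E) 𝓘(ℝ, E) d.glue a (JA a v) =
      JB (d.glue a) (mfderiv 𝓘(ℝ, E) 𝓘(ℝ, E) d.glue a v)) :
    AlmostComplexStructure 𝓘(ℝ, E) ∞ d.Glued where
  toFun := glueEnd d JA JB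
  map_map' y v := by
    rcases d.exists_inl_or_inr y with ⟨a, rfl⟩ | ⟨b, rfl⟩
    · rw [glueEnd_of_mem_inl JA JB (mem_range_self a)]
      exact pushEnd_pushEnd d.isSmoothEmbedding_inl d.isOpen_range_inl JA (mem_range_self a) v
    · rw [glueEnd_of_mem_inr JA JB hol (mem_range_self b)]
      exact pushEnd_pushEnd d.isSmoothEmbedding_inr d.isOpen_range_inr JB (mem_range_self b) v
  contMDiff' y := by
    rcases d.exists_inl_or_inr y with ⟨a, rfl⟩ | ⟨b, rfl⟩
    · refine (contMDiffAt_pushEnd d.isSmoothEmbedding_inl d.isOpen_range_inl JA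
        (mem_range_self a)).congr_of_eventuallyEq ?_
      filter_upwards [d.isOpen_range_inl.mem_nhds (mem_range_self a)] with y hy
      rw [glueEnd_of_mem_inl JA JB hy]
    · refine (contMDiffAt_pushEnd d.isSmoothEmbedding_inr d.isOpen_range_inr JB
        (mem_range_self b)).congr_of_eventuallyEq ?_
      filter_upwards [d.isOpen_range_inr.mem_nhds (mem_range_self b)] with y hy
      rw [glueEnd_of_mem_inr JA JB hol hy]

variable {JA : AlmostComplexStructure 𝓘(ℝ, E) ∞ A} {JB : AlmostComplexStructure 𝓘(ℝ, E) ∞ B}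
  {hol : ∀ a ∈ d.glue.source, ∀ v : E, mfderiv 𝓘(ℝ, E) 𝓘(ℝ, E) d.glue a (JA a v) =
    JB (d.glue a) (mfderiv 𝓘(ℝ, E) 𝓘(ℝ, E) d.glue a v)}

/-- The glued structure, applied. [folklore] -/
theorem glueACS_apply (y : d.Glued) : glueACS d JA JB hol y = glueEnd d JA JB y := rfl

/-- **`inl` is `(J_A, J)`-holomorphic** for the glued structure `J`. [cite: McDuffSalamon2017, §4.1] -/
theorem glueACS_inl (a : A) (v : E) :
    glueACS d JA JB hol (d.inl a) (mfderiv 𝓘(ℝ, E) 𝓘(ℝ, E) d.inl a v) =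
      mfderiv 𝓘(ℝ, E) 𝓘(ℝ, E) d.inl a (JA a v) := by
  rw [glueACS_apply, glueEnd_of_mem_inl JA JB (mem_range_self a),
    pushEnd_mfderiv d.isSmoothEmbedding_inl d.isOpen_range_inl]

/-- **`inr` is `(J_B, J)`-holomorphic** for the glued structure `J`. [cite: McDuffSalamon2017, §4.1] -/
theorem glueACS_inr (b : B) (v : E) :
    glueACS d JA JB hol (d.inr b) (mfderiv 𝓘(ℝ, E) 𝓘(ℝ, E) d.inr b v) =
      mfderiv 𝓘(ℝ, E) 𝓘(ℝ, E) d.inr b (JB b v) := by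
  rw [glueACS_apply, glueEnd_of_mem_inr JA JB hol (mem_range_self b),
    pushEnd_mfderiv d.isSmoothEmbedding_inr d.isOpen_range_inr]

end GlueJ

end CapModel

/-- **Registered helper sub-goal `helper_capModelGlueACS`** (generic auxiliary file of stub
`stub_capModel`): almost complex structures on the two pieces of an open gluing of `4`-manifolds,
for which the gluing map is holomorphic, glue to an almost complex structure on the pushout for
which both pieces are holomorphically embedded. [cite: McDuffSalamon2017, §4.1] -/
theorem helper_capModelGlueACS : ∀ (A B : Type) [TopologicalSpace A]
    [ChartedSpace (EuclideanSpace ℝ (Fin 4)) A] [IsManifold (𝓡 4) ∞ A] [TopologicalSpace B]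
    [ChartedSpace (EuclideanSpace ℝ (Fin 4)) B] [IsManifold (𝓡 4) ∞ B] [Nonempty A] [Nonempty B]
    (d : Literature.Topology.FourManifolds.SmoothGlueData (𝓡 4) (𝓡 4) A B
      (EuclideanSpace ℝ (Fin 4)))
    (JA : Literature.Geometry.Symplectic.AlmostComplexStructure (𝓡 4) ∞ A)
    (JB : Literature.Geometry.Symplectic.AlmostComplexStructure (𝓡 4) ∞ B),
    (∀ a ∈ d.glue.source, ∀ v : EuclideanSpace ℝ (Fin 4),
      mfderiv (𝓡 4) (𝓡 4) d.glue a (JA a v) = JB (d.glue a) (mfderiv (𝓡 4) (𝓡 4) d.glue a v)) →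
    ∃ J : Literature.Geometry.Symplectic.AlmostComplexStructure (𝓡 4) ∞ d.Glued,
      (∀ (a : A) (v : EuclideanSpace ℝ (Fin 4)),
        J (d.inl a) (mfderiv (𝓡 4) (𝓡 4) d.inl a v) = mfderiv (𝓡 4) (𝓡 4) d.inl a (JA a v)) ∧
      ∀ (b : B) (v : EuclideanSpace ℝ (Fin 4)),
        J (d.inr b) (mfderiv (𝓡 4) (𝓡 4) d.inr b v) = mfderiv (𝓡 4) (𝓡 4) d.inr b (JB b v) :=
  fun _ _ _ _ _ _ _ _ _ _ d JA JB hol => ⟨CapModel.GlueJ.glueACS d JA JB hol,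
    fun a v => CapModel.GlueJ.glueACS_inl d a v, fun b v => CapModel.GlueJ.glueACS_inr d b v⟩

end Summit.SmoothPoincare4.SmoothPoincare4.Theorems.GromovRecognitionRelEnd.CrossCapLaurent
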